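import Mathlib
import HarnessLib
import Literature.NumberTheory.LFunctions.ZetaSubconvexity
import Literature.NumberTheory.LFunctions.ZetaSubconvexityEq42
import Literature.NumberTheory.LFunctions.ZetaSubconvexityRobertSargos
import Literature.NumberTheory.LFunctions.RobertSargosFourthDerivativeProofs

/-!
# Bourgain 2017, eq. (4.1) (Huxley's bound `|S| ≪ T^{(4+103α)/128+ε}`) for `F = log`:
# the range `α ≥ 76/187` PROVED, and the reductions of the named fact to its core ranges

Topic `Literature/NumberTheory/LFunctions`. Bourgain, *J. Amer. Math. Soc.* **30** (2017), §5,
eq. (4.1): "one can employ the bound `|S| ≪ T^{(4+103α)/128+ε}` (`12/31 < α ≤ 1`), which is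
[H1], Theorem 3" (Huxley, *Exponential sums and the Riemann zeta function IV*, Proc. LMS (3) 66
(1993)), for `S = ∑_{M/2 ≤ m ≤ M} e(T F(m/M))`, `α = log M / log T`. The named fact
`Literature.NumberTheory.LFunctions.Bourgain2017_eq41_log` (`ZetaSubconvexity.lean`) records it for
`F = log` on `T^{12/31} < M ≤ √T`.

Writing `T^{(4+103α)/128} = T^{1/32} M^{103/128}`
(`Literature.NumberTheory.LFunctions.rpow_eq41_exponent`), the bound (4.1) is a consequence of
the exponent pair `(1/9, 13/18)`, Bourgain's (4.2) `|S| ≪ (T/M)^{1/9} M^{13/18} = T^{1/9} M^{11/18}`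
— PROVED in this tree for `F = log` (`Literature.NumberTheory.LFunctions.Bourgain2017_eq42_log_holds`,
`ZetaSubconvexityEq42.lean`) — exactly when `T^{1/9 - 1/32} = T^{23/288} ≤ M^{103/128 - 11/18} =
M^{223/1152}`, i.e. when `M ≥ T^{92/223}` (`α ≥ 92/223 = 0.41255…`). This file proves that part
unconditionally and reduces the named fact to the remaining *core* range
`T^{12/31} < M < T^{92/223}`:

* `Literature.NumberTheory.LFunctions.Bourgain2017_eq41_log_on_ge_strong` — PROVED: there are
  `C, T₀` with `‖S‖ ≤ C T^{(4+103α)/128}` for `T ≥ T₀`, `T^{92/223} ≤ M ≤ T` (no `ε`, and up to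
  `M ≤ T`).
* `Literature.NumberTheory.LFunctions.Bourgain2017_eq41_log_on_ge` — PROVED: the same in the shape
  of the named fact (`∀ ε > 0 ∃ C T₀ …`, `T^{92/223} ≤ M ≤ √T`).
* `Literature.NumberTheory.LFunctions.Bourgain2017_eq41_log_of_core` — PROVED:
  `Bourgain2017_eq41_log` follows from its restriction to `T^{12/31} < M < T^{92/223}`.

Conditionally on the two other exponential-sum estimates recorded as named facts in this tree the
core shrinks further (all PROVED here; `Literature.NumberTheory.LFunctions.Bourgain2017_eq41_log_of_split`
is the common glue):

* from the Robert–Sargos fourth-derivative test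
  (`Literature.NumberTheory.LFunctions.Sargos2003_lemma4`, through
  `Literature.NumberTheory.LFunctions.norm_bourgainSum_log_le_of_sargos`:
  `‖S‖ ≪_ε M^ε (M^{9/13} T^{1/13} + M^{28/13} T^{-7/13})`): `M^{9/13} T^{1/13} ≤ T^{1/32} M^{103/128}`
  iff `M ≥ T^{76/187}` and `M^{28/13} T^{-7/13} ≤ T^{1/32} M^{103/128}` iff `M ≤ T^{948/2245}`
  (`948/2245 > 92/223`), so (4.1) holds for `F = log` on `T^{76/187} ≤ M ≤ √T`
  (`Literature.NumberTheory.LFunctions.Bourgain2017_eq41_log_on_ge_of_sargos`) and the fact follows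
  from its restriction to `T^{12/31} < M < T^{76/187}` (`α < 0.4064…`,
  `Literature.NumberTheory.LFunctions.Bourgain2017_eq41_log_of_sargos_of_core`);
* from Bourgain's Theorem 4 (`Literature.NumberTheory.LFunctions.Bourgain2017_theorem4_log`:
  `‖S‖ ≪_ε M^{1/2} T^{13/84+ε}` on `T^{17/42} ≤ M ≤ √T`): `M^{1/2} T^{13/84} ≤ T^{1/32} M^{103/128}`
  iff `T^{83/672} ≤ M^{39/128}` iff `M ≥ T^{332/819}` (`332/819 = 0.4053… > 17/42`), so (4.1) holds
  for `F = log` on `T^{332/819} ≤ M ≤ √T`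
  (`Literature.NumberTheory.LFunctions.Bourgain2017_eq41_log_on_ge_of_theorem4`) and the fact
  follows from its restriction to `T^{12/31} < M < T^{332/819}`
  (`Literature.NumberTheory.LFunctions.Bourgain2017_eq41_log_of_theorem4_of_core`). This is the
  range on which §5 of the paper genuinely uses [H1], Theorem 3 (there (4.1) is invoked for
  `12/31 < α < 17/42`, Theorem 4 taking over from `17/42 < 332/819`).

## The Robert–Sargos range is unconditional

`Literature.NumberTheory.LFunctions.Sargos2003_lemma4` is a theorem of this tree
(`Literature.NumberTheory.LFunctions.Sargos2003_lemma4_holds`, file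
`RobertSargosFourthDerivativeProofs.lean`: Robert–Sargos 2002, Theorem 1, proved along §4 of that
paper), so the first of the two conditional reductions above is in fact unconditional:

* `Literature.NumberTheory.LFunctions.Bourgain2017_eq41_log_on_ge_sargos` — PROVED: (4.1) for
  `F = log` on `T^{76/187} ≤ M ≤ √T` (`α ≥ 76/187 = 0.4064…`), in the shape of the named fact;
* `Literature.NumberTheory.LFunctions.Bourgain2017_eq41_log_of_core_sargos` — PROVED:
  `Bourgain2017_eq41_log` follows from its restriction to the core `T^{12/31} < M < T^{76/187}`.

## Why the core `12/31 < α < 332/819` is not touched here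

On `(12/31, 92/223)` no estimate proved in this tree, and no classical van der Corput exponent pair,
reaches the exponent `1/32 + 103α/128`: at `α = 12/31` it equals `85/248 = 0.34274…`, below
everything obtainable from `A`/`B` processes (best `≈ 0.34598`), below the fourth-derivative test
and below Robert–Sargos (`Literature.NumberTheory.LFunctions.Sargos2003_lemma4`, useful only from
`α ≥ 76/187 = 0.4064…`) and Bourgain's Theorem 4 (useful only from `α ≥ 332/819 = 0.4053…`). In the table of sharpest known bounds `β(α)` of Trudgian–Yang
(arXiv:2306.05599, §3, Table 2) the row `1/32 + 103α/128` on `[12/31, 1508/3825]` is credited to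
Huxley's monograph [H], Table 17.1 (the once-differenced Bombieri–Iwaniec method with Huxley's
resonance-curve treatment of the second spacing problem, [H1] §§7–8), and the hull vertex
`(1508/3825, 1333/3825)` lies on it: there it *is* the best known bound. Discharging the core thus
means formalising [H1], Theorem 3 itself; nothing in this file is specific to that method.

## Faithfulness notes

* As in `ZetaSubconvexity.lean`: Bourgain's `T` is `t/2π`, `m ∼ M` is `M/2 ≤ m ≤ M`
  (`Literature.NumberTheory.LFunctions.bourgainSum`), `≪` for `T` large is `∃ C T₀, ∀ T ≥ T₀`.
* `92/223` is the exact crossover of the two exponents `1/9 + 11α/18` and `1/32 + 103α/128`;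
  Bourgain's own "calculation shows" in §5 uses (4.2) only up to `11/28 < 92/223` because his
  target there is (3.19), not (4.1).
* The hypothesis of `Bourgain2017_eq41_log_of_core` is the named fact verbatim with the extra
  upper constraint `M < T^{92/223}`; it is weaker than the fact, not a restatement of it, and is
  not introduced as a named fact (D-0026). The same holds for the core hypotheses of
  `Bourgain2017_eq41_log_of_sargos_of_core` (`M < T^{76/187}`) and
  `Bourgain2017_eq41_log_of_theorem4_of_core` (`M < T^{332/819}`); their other hypothesis is an
  existing named fact of the tree (`Sargos2003_lemma4`, resp. `Bourgain2017_theorem4_log`), used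
  as printed.
* `76/187`, `948/2245` and `332/819` are the exact crossovers of `9α/13 + 1/13`,
  `28α/13 - 7/13` and `α/2 + 13/84` with `1/32 + 103α/128`. The Robert–Sargos range needs `T`
  large only to ensure `M ≥ 24` and `M⁴ ≥ 120 T` for `M ≥ T^{76/187}` (`T ≥ 14400` suffices).

## References

* J. Bourgain, *Decoupling, exponential sums and the Riemann zeta function*, J. Amer. Math. Soc.
  30 (2017), 205–224 (arXiv:1408.5794), §5, eqs. (4.1), (4.2). [cite: BourgainJAMS2017, §5 (4.1)–(4.2)]
* M. N. Huxley, *Exponential sums and the Riemann zeta function IV*, Proc. London Math. Soc. (3)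
  66 (1993), 1–40, Theorem 3. [cite: Huxley1993, Theorem 3 (as quoted in Bourgain (4.1))]
* M. N. Huxley, *Area, Lattice Points, and Exponential Sums*, LMS Monographs 13, OUP (1996),
  Table 17.1.
* T. S. Trudgian, A. Yang, *Toward optimal exponent pairs*, arXiv:2306.05599, §3, Table 2.
* O. Robert, P. Sargos, *A fourth derivative test for exponential sums*, Compositio Math. 130
  (2002), 275–292, Theorem 1; P. Sargos, Acta Arith. 110 (2003), Lemma 4. [cite: Sargos2003, Lemma 4]
-/

noncomputable section

open Real Complex Finset

namespace Literature.NumberTheory.LFunctions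

/-- The exponent of (4.1) split off: `T^{(4+103α)/128 + ε} = T^{1/32 + ε} · M^{103/128}` for
`T > 1`, `M > 0`, `α = log M / log T`. [cite: BourgainJAMS2017, §5, the "calculation" after (4.2)] -/
theorem rpow_eq41_exponent {T M : ℝ} (hT : 1 < T) (hM : 0 < M) (ε : ℝ) :
    T ^ ((4 + 103 * (Real.log M / Real.log T)) / 128 + ε) =
      T ^ (1 / 32 + ε) * M ^ ((103 : ℝ) / 128) := by
  have hTpos : (0 : ℝ) < T := by linarith
  have hlogT : 0 < Real.log T := Real.log_pos hT
  have hpow : T ^ ((103 : ℝ) / 128 * (Real.log M / Real.log T)) = M ^ ((103 : ℝ) / 128) := by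
    rw [Real.rpow_def_of_pos hTpos, Real.rpow_def_of_pos hM]
    congr 1
    field_simp
  rw [← hpow, ← Real.rpow_add hTpos]
  congr 1
  ring

/-- **(4.1) for `F = log` on `α ≥ 92/223`, from the exponent pair `(1/9, 13/18)` (4.2).** There are
`C, T₀` such that `‖∑_{M/2 ≤ m ≤ M} e(T log(m/M))‖ ≤ C · T^{(4+103α)/128}` (`α = log M/log T`)
whenever `T ≥ T₀` and `T^{92/223} ≤ M ≤ T`: indeed `T^{1/9} M^{11/18} = T^{23/288} T^{1/32} M^{11/18}
≤ M^{223/1152} T^{1/32} M^{11/18} = T^{1/32} M^{103/128}` as soon as `T^{92/223} ≤ M`.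
[cite: BourgainJAMS2017, §5 (4.1), (4.2)] -/
theorem Bourgain2017_eq41_log_on_ge_strong :
    ∃ C T₀ : ℝ, ∀ T : ℝ, T₀ ≤ T → ∀ M : ℝ, T ^ (92 / 223 : ℝ) ≤ M → M ≤ T →
      ‖bourgainSum Real.log T M‖ ≤ C * T ^ ((4 + 103 * (Real.log M / Real.log T)) / 128) := by
  obtain ⟨C, T₀, H⟩ := Bourgain2017_eq42_log_holds
  refine ⟨|C|, max T₀ 2, ?_⟩
  intro T hT M hTM hMT
  have hT₀ : T₀ ≤ T := le_trans (le_max_left _ _) hT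
  have hT2 : (2 : ℝ) ≤ T := le_trans (le_max_right _ _) hT
  have hT1 : (1 : ℝ) < T := by linarith
  have hTpos : (0 : ℝ) < T := by linarith
  have hM1 : (1 : ℝ) ≤ M := le_trans (Real.one_le_rpow hT1.le (by norm_num)) hTM
  have hMpos : (0 : ℝ) < M := by linarith
  -- the exponent of (4.1), split: `T^{(4+103α)/128} = T^{1/32} M^{103/128}`
  have hsplit : T ^ ((4 + 103 * (Real.log M / Real.log T)) / 128) =
      T ^ ((1 : ℝ) / 32) * M ^ ((103 : ℝ) / 128) := by
    have h := rpow_eq41_exponent hT1 hMpos 0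
    rw [add_zero, add_zero] at h
    exact h
  -- the comparison `T^{23/288} ≤ M^{223/1152}` from `T^{92/223} ≤ M`
  have h23 : T ^ ((23 : ℝ) / 288) ≤ M ^ ((223 : ℝ) / 1152) := by
    calc T ^ ((23 : ℝ) / 288) = (T ^ (92 / 223 : ℝ)) ^ ((223 : ℝ) / 1152) := by
          rw [← Real.rpow_mul hTpos.le]
          norm_num
      _ ≤ M ^ ((223 : ℝ) / 1152) := Real.rpow_le_rpow (by positivity) hTM (by norm_num)
  have e1 : (T / M) ^ (1 / 9 : ℝ) * M ^ (13 / 18 : ℝ) =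
      T ^ ((23 : ℝ) / 288) * (T ^ ((1 : ℝ) / 32) * M ^ ((11 : ℝ) / 18)) := by
    simp only [Real.rpow_def_of_pos hTpos, Real.rpow_def_of_pos hMpos,
      Real.rpow_def_of_pos (div_pos hTpos hMpos), ← Real.exp_add]
    rw [Real.log_div hTpos.ne' hMpos.ne']
    congr 1
    ring
  have e2 : M ^ ((223 : ℝ) / 1152) * (T ^ ((1 : ℝ) / 32) * M ^ ((11 : ℝ) / 18)) =
      T ^ ((1 : ℝ) / 32) * M ^ ((103 : ℝ) / 128) := by
    simp only [Real.rpow_def_of_pos hTpos, Real.rpow_def_of_pos hMpos, ← Real.exp_add]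
    congr 1
    ring
  have key : (T / M) ^ (1 / 9 : ℝ) * M ^ (13 / 18 : ℝ) ≤
      T ^ ((4 + 103 * (Real.log M / Real.log T)) / 128) := by
    rw [hsplit, e1, ← e2]
    exact mul_le_mul_of_nonneg_right h23 (by positivity)
  calc ‖bourgainSum Real.log T M‖ ≤ C * (T / M) ^ (1 / 9 : ℝ) * M ^ (13 / 18 : ℝ) :=
        H T hT₀ M hM1 hMT
    _ = C * ((T / M) ^ (1 / 9 : ℝ) * M ^ (13 / 18 : ℝ)) := by ring
    _ ≤ |C| * ((T / M) ^ (1 / 9 : ℝ) * M ^ (13 / 18 : ℝ)) :=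
        mul_le_mul_of_nonneg_right (le_abs_self _) (by positivity)
    _ ≤ |C| * T ^ ((4 + 103 * (Real.log M / Real.log T)) / 128) :=
        mul_le_mul_of_nonneg_left key (abs_nonneg _)

/-- **(4.1) for `F = log` on `T^{92/223} ≤ M ≤ √T`, in the shape of the named fact
`Literature.NumberTheory.LFunctions.Bourgain2017_eq41_log`** (for every `ε > 0` there are `C, T₀`
with `‖S‖ ≤ C T^{(4+103α)/128+ε}` for `T ≥ T₀`, `T^{92/223} ≤ M ≤ √T`); PROVED from
`Bourgain2017_eq41_log_on_ge_strong`. [cite: BourgainJAMS2017, §5 (4.1), (4.2)] -/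
theorem Bourgain2017_eq41_log_on_ge :
    ∀ ε : ℝ, 0 < ε → ∃ C T₀ : ℝ, ∀ T : ℝ, T₀ ≤ T → ∀ M : ℝ,
      T ^ (92 / 223 : ℝ) ≤ M → M ≤ Real.sqrt T →
        ‖bourgainSum Real.log T M‖ ≤
          C * T ^ ((4 + 103 * (Real.log M / Real.log T)) / 128 + ε) := by
  intro ε hε
  obtain ⟨C, T₀, H⟩ := Bourgain2017_eq41_log_on_ge_strong
  refine ⟨|C|, max T₀ 1, ?_⟩
  intro T hT M hTM hMT
  have hT₀ : T₀ ≤ T := le_trans (le_max_left _ _) hT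
  have hT1 : (1 : ℝ) ≤ T := le_trans (le_max_right _ _) hT
  have hTpos : (0 : ℝ) < T := by linarith
  have hMT' : M ≤ T := by
    refine hMT.trans ?_
    calc Real.sqrt T ≤ Real.sqrt (T ^ 2) := Real.sqrt_le_sqrt (by nlinarith)
      _ = T := Real.sqrt_sq hTpos.le
  calc ‖bourgainSum Real.log T M‖
      ≤ C * T ^ ((4 + 103 * (Real.log M / Real.log T)) / 128) := H T hT₀ M hTM hMT'
    _ ≤ |C| * T ^ ((4 + 103 * (Real.log M / Real.log T)) / 128) :=
        mul_le_mul_of_nonneg_right (le_abs_self _) (by positivity)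
    _ ≤ |C| * T ^ ((4 + 103 * (Real.log M / Real.log T)) / 128 + ε) :=
        mul_le_mul_of_nonneg_left (Real.rpow_le_rpow_of_exponent_le hT1 (by linarith))
          (abs_nonneg _)

/-- **Reduction of the named fact to its core range.** `Bourgain2017_eq41_log` (Huxley's (4.1) for
`F = log` on `T^{12/31} < M ≤ √T`) follows from the same statement restricted to
`T^{12/31} < M < T^{92/223}` — the range where [H1], Theorem 3 is the only known source of the
exponent `1/32 + 103α/128` — the rest being `Bourgain2017_eq41_log_on_ge`.
[cite: BourgainJAMS2017, §5 (4.1)] [cite: Huxley1993, Theorem 3 (as quoted in Bourgain (4.1))] -/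
theorem Bourgain2017_eq41_log_of_core
    (h : ∀ ε : ℝ, 0 < ε → ∃ C T₀ : ℝ, ∀ T : ℝ, T₀ ≤ T → ∀ M : ℝ,
      T ^ (12 / 31 : ℝ) < M → M < T ^ (92 / 223 : ℝ) →
        ‖bourgainSum Real.log T M‖ ≤
          C * T ^ ((4 + 103 * (Real.log M / Real.log T)) / 128 + ε)) :
    Bourgain2017_eq41_log := by
  intro ε hε
  obtain ⟨C₁, T₁, H₁⟩ := h ε hε
  obtain ⟨C₂, T₂, H₂⟩ := Bourgain2017_eq41_log_on_ge ε hε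
  refine ⟨|C₁| + |C₂|, max (max T₁ T₂) 1, ?_⟩
  intro T hT M hlow hMT
  have hT₁ : T₁ ≤ T := le_trans ((le_max_left _ _).trans (le_max_left _ _)) hT
  have hT₂ : T₂ ≤ T := le_trans ((le_max_right _ _).trans (le_max_left _ _)) hT
  have hT1 : (1 : ℝ) ≤ T := le_trans (le_max_right _ _) hT
  have hX : 0 ≤ T ^ ((4 + 103 * (Real.log M / Real.log T)) / 128 + ε) := by positivity
  by_cases hc : M < T ^ (92 / 223 : ℝ)
  · calc ‖bourgainSum Real.log T M‖
        ≤ C₁ * T ^ ((4 + 103 * (Real.log M / Real.log T)) / 128 + ε) := H₁ T hT₁ M hlow hc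
      _ ≤ |C₁| * T ^ ((4 + 103 * (Real.log M / Real.log T)) / 128 + ε) :=
          mul_le_mul_of_nonneg_right (le_abs_self _) hX
      _ ≤ (|C₁| + |C₂|) * T ^ ((4 + 103 * (Real.log M / Real.log T)) / 128 + ε) :=
          mul_le_mul_of_nonneg_right (by linarith [abs_nonneg C₂]) hX
  · rw [not_lt] at hc
    calc ‖bourgainSum Real.log T M‖
        ≤ C₂ * T ^ ((4 + 103 * (Real.log M / Real.log T)) / 128 + ε) := H₂ T hT₂ M hc hMT
      _ ≤ |C₂| * T ^ ((4 + 103 * (Real.log M / Real.log T)) / 128 + ε) :=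
          mul_le_mul_of_nonneg_right (le_abs_self _) hX
      _ ≤ (|C₁| + |C₂|) * T ^ ((4 + 103 * (Real.log M / Real.log T)) / 128 + ε) :=
          mul_le_mul_of_nonneg_right (by linarith [abs_nonneg C₁]) hX


/-! ## Conditional reductions: smaller cores from Robert–Sargos and from Theorem 4 -/

/-- **Glue.** For any `θ`, `Bourgain2017_eq41_log` follows from (4.1) (for `F = log`, in the shape
of the named fact) on `T^{12/31} < M < T^θ` together with (4.1) on `T^θ ≤ M ≤ √T`. [folklore] -/
theorem Bourgain2017_eq41_log_of_split (θ : ℝ)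
    (hlow : ∀ ε : ℝ, 0 < ε → ∃ C T₀ : ℝ, ∀ T : ℝ, T₀ ≤ T → ∀ M : ℝ,
      T ^ (12 / 31 : ℝ) < M → M < T ^ θ →
        ‖bourgainSum Real.log T M‖ ≤
          C * T ^ ((4 + 103 * (Real.log M / Real.log T)) / 128 + ε))
    (hhigh : ∀ ε : ℝ, 0 < ε → ∃ C T₀ : ℝ, ∀ T : ℝ, T₀ ≤ T → ∀ M : ℝ,
      T ^ θ ≤ M → M ≤ Real.sqrt T →
        ‖bourgainSum Real.log T M‖ ≤
          C * T ^ ((4 + 103 * (Real.log M / Real.log T)) / 128 + ε)) :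
    Bourgain2017_eq41_log := by
  intro ε hε
  obtain ⟨C₁, T₁, H₁⟩ := hlow ε hε
  obtain ⟨C₂, T₂, H₂⟩ := hhigh ε hε
  refine ⟨|C₁| + |C₂|, max (max T₁ T₂) 1, ?_⟩
  intro T hT M hlowM hMT
  have hT₁ : T₁ ≤ T := le_trans ((le_max_left _ _).trans (le_max_left _ _)) hT
  have hT₂ : T₂ ≤ T := le_trans ((le_max_right _ _).trans (le_max_left _ _)) hT
  have hT1 : (1 : ℝ) ≤ T := le_trans (le_max_right _ _) hT
  have hX : 0 ≤ T ^ ((4 + 103 * (Real.log M / Real.log T)) / 128 + ε) :=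
    Real.rpow_nonneg (by linarith) _
  by_cases hc : M < T ^ θ
  · calc ‖bourgainSum Real.log T M‖
        ≤ C₁ * T ^ ((4 + 103 * (Real.log M / Real.log T)) / 128 + ε) := H₁ T hT₁ M hlowM hc
      _ ≤ |C₁| * T ^ ((4 + 103 * (Real.log M / Real.log T)) / 128 + ε) :=
          mul_le_mul_of_nonneg_right (le_abs_self _) hX
      _ ≤ (|C₁| + |C₂|) * T ^ ((4 + 103 * (Real.log M / Real.log T)) / 128 + ε) :=
          mul_le_mul_of_nonneg_right (by linarith [abs_nonneg C₂]) hX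
  · rw [not_lt] at hc
    calc ‖bourgainSum Real.log T M‖
        ≤ C₂ * T ^ ((4 + 103 * (Real.log M / Real.log T)) / 128 + ε) := H₂ T hT₂ M hc hMT
      _ ≤ |C₂| * T ^ ((4 + 103 * (Real.log M / Real.log T)) / 128 + ε) :=
          mul_le_mul_of_nonneg_right (le_abs_self _) hX
      _ ≤ (|C₁| + |C₂|) * T ^ ((4 + 103 * (Real.log M / Real.log T)) / 128 + ε) :=
          mul_le_mul_of_nonneg_right (by linarith [abs_nonneg C₁]) hX

/-- **(4.1) for `F = log` on `T^{76/187} ≤ M ≤ T^{92/223}` from the Robert–Sargos test.** If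
`Sargos2003_lemma4` holds then for every `ε > 0` there is `C` with
`‖S‖ ≤ C T^{(4+103α)/128+ε}` for `T ≥ 14400`, `T^{76/187} ≤ M ≤ T^{92/223}`: by
`norm_bourgainSum_log_le_of_sargos`, `‖S‖ ≤ C M^ε (M^{9/13}T^{1/13} + M^{28/13}T^{-7/13})`, and
`M^{9/13} T^{1/13} = T^{19/416} T^{1/32} M^{9/13} ≤ M^{187/1664} T^{1/32} M^{9/13} = T^{1/32} M^{103/128}`
(as `T^{76/187} ≤ M`), `M^{28/13} T^{-7/13} = M^{2245/1664} T^{-237/416} · T^{1/32} M^{103/128} ≤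
T^{1/32} M^{103/128}` (as `M ≤ T^{92/223} ≤ T^{948/2245}`).
[cite: Sargos2003, Lemma 4] [cite: BourgainJAMS2017, §5 (4.1)] -/
theorem Bourgain2017_eq41_log_on_sargos_range (h : Sargos2003_lemma4) {ε : ℝ} (hε : 0 < ε) :
    ∃ C : ℝ, ∀ T : ℝ, 14400 ≤ T → ∀ M : ℝ,
      T ^ (76 / 187 : ℝ) ≤ M → M ≤ T ^ (92 / 223 : ℝ) →
        ‖bourgainSum Real.log T M‖ ≤
          C * T ^ ((4 + 103 * (Real.log M / Real.log T)) / 128 + ε) := by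
  obtain ⟨C, hC⟩ := norm_bourgainSum_log_le_of_sargos h hε
  refine ⟨2 * |C|, fun T hT M hTM hMT => ?_⟩
  have hT1 : (1 : ℝ) < T := by linarith
  have hTpos : (0 : ℝ) < T := by linarith
  -- `M ≥ T^{76/187} ≥ T^{1/3} ≥ 24`
  have hM24 : (24 : ℝ) ≤ M := by
    refine le_trans ?_ hTM
    calc (24 : ℝ) = (13824 : ℝ) ^ ((1 : ℝ) / 3) := by
          rw [show (13824 : ℝ) = (24 : ℝ) ^ (3 : ℝ) by norm_num, ← Real.rpow_mul (by norm_num)]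
          norm_num
      _ ≤ T ^ ((1 : ℝ) / 3) := Real.rpow_le_rpow (by norm_num) (by linarith) (by norm_num)
      _ ≤ T ^ (76 / 187 : ℝ) := Real.rpow_le_rpow_of_exponent_le hT1.le (by norm_num)
  have hMpos : (0 : ℝ) < M := by linarith
  have hMT1 : M ≤ T := hMT.trans (by
    calc T ^ (92 / 223 : ℝ) ≤ T ^ (1 : ℝ) := Real.rpow_le_rpow_of_exponent_le hT1.le (by norm_num)
      _ = T := Real.rpow_one T)
  -- `120 T ≤ M⁴`: `M⁴ ≥ T^{304/187} = T^{117/187} · T ≥ T^{1/2} · T ≥ 120 T`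
  have h120 : 120 * T ≤ M ^ 4 := by
    have h4 : (T ^ (76 / 187 : ℝ)) ^ (4 : ℕ) ≤ M ^ (4 : ℕ) := by gcongr
    have hsq : (120 : ℝ) ≤ T ^ ((1 : ℝ) / 2) := by
      rw [← Real.sqrt_eq_rpow]
      calc (120 : ℝ) = Real.sqrt (120 ^ 2) := by rw [Real.sqrt_sq (by norm_num)]
        _ ≤ Real.sqrt T := Real.sqrt_le_sqrt (by linarith)
    have hpow : (T ^ (76 / 187 : ℝ)) ^ (4 : ℕ) = T ^ ((117 : ℝ) / 187) * T := by
      rw [← Real.rpow_natCast, ← Real.rpow_mul hTpos.le]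
      conv_rhs => rw [← Real.rpow_one T, ← Real.rpow_mul hTpos.le, ← Real.rpow_add hTpos]
      norm_num
    calc 120 * T ≤ T ^ ((1 : ℝ) / 2) * T := mul_le_mul_of_nonneg_right hsq hTpos.le
      _ ≤ T ^ ((117 : ℝ) / 187) * T := mul_le_mul_of_nonneg_right
          (Real.rpow_le_rpow_of_exponent_le hT1.le (by norm_num)) hTpos.le
      _ = (T ^ (76 / 187 : ℝ)) ^ (4 : ℕ) := hpow.symm
      _ ≤ M ^ 4 := h4
  have hS := hC T hT1.le M hM24 h120
  -- the exponent of (4.1), split: `T^{(4+103α)/128+ε} = T^{1/32+ε} M^{103/128}`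
  have hsplit := rpow_eq41_exponent hT1 hMpos ε
  -- first term: `M^{9/13} T^{1/13} ≤ T^{1/32} M^{103/128}`
  have h19 : T ^ ((19 : ℝ) / 416) ≤ M ^ ((187 : ℝ) / 1664) := by
    calc T ^ ((19 : ℝ) / 416) = (T ^ (76 / 187 : ℝ)) ^ ((187 : ℝ) / 1664) := by
          rw [← Real.rpow_mul hTpos.le]
          norm_num
      _ ≤ M ^ ((187 : ℝ) / 1664) := Real.rpow_le_rpow (by positivity) hTM (by norm_num)
  have h1 : M ^ (9 / 13 : ℝ) * T ^ (1 / 13 : ℝ) ≤ T ^ ((1 : ℝ) / 32) * M ^ ((103 : ℝ) / 128) := by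
    have e1 : M ^ (9 / 13 : ℝ) * T ^ (1 / 13 : ℝ) =
        T ^ ((19 : ℝ) / 416) * (T ^ ((1 : ℝ) / 32) * M ^ ((9 : ℝ) / 13)) := by
      simp only [Real.rpow_def_of_pos hTpos, Real.rpow_def_of_pos hMpos, ← Real.exp_add]
      congr 1
      ring
    have e2 : M ^ ((187 : ℝ) / 1664) * (T ^ ((1 : ℝ) / 32) * M ^ ((9 : ℝ) / 13)) =
        T ^ ((1 : ℝ) / 32) * M ^ ((103 : ℝ) / 128) := by
      simp only [Real.rpow_def_of_pos hTpos, Real.rpow_def_of_pos hMpos, ← Real.exp_add]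
      congr 1
      ring
    rw [e1, ← e2]
    exact mul_le_mul_of_nonneg_right h19 (by positivity)
  -- second term: `M^{28/13} T^{-7/13} ≤ T^{1/32} M^{103/128}`
  have h2245 : M ^ ((2245 : ℝ) / 1664) ≤ T ^ ((237 : ℝ) / 416) := by
    calc M ^ ((2245 : ℝ) / 1664) ≤ (T ^ (92 / 223 : ℝ)) ^ ((2245 : ℝ) / 1664) :=
          Real.rpow_le_rpow hMpos.le hMT (by norm_num)
      _ = T ^ ((92 : ℝ) / 223 * (2245 / 1664)) := by rw [← Real.rpow_mul hTpos.le]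
      _ ≤ T ^ ((237 : ℝ) / 416) := Real.rpow_le_rpow_of_exponent_le hT1.le (by norm_num)
  have h2 : M ^ (28 / 13 : ℝ) * T ^ (-(7 / 13 : ℝ)) ≤ T ^ ((1 : ℝ) / 32) * M ^ ((103 : ℝ) / 128) := by
    have e1 : M ^ (28 / 13 : ℝ) * T ^ (-(7 / 13 : ℝ)) =
        M ^ ((2245 : ℝ) / 1664) *
          (T ^ (-((237 : ℝ) / 416)) * (T ^ ((1 : ℝ) / 32) * M ^ ((103 : ℝ) / 128))) := by
      simp only [Real.rpow_def_of_pos hTpos, Real.rpow_def_of_pos hMpos, ← Real.exp_add]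
      congr 1
      ring
    have e2 : T ^ ((237 : ℝ) / 416) *
          (T ^ (-((237 : ℝ) / 416)) * (T ^ ((1 : ℝ) / 32) * M ^ ((103 : ℝ) / 128))) =
        T ^ ((1 : ℝ) / 32) * M ^ ((103 : ℝ) / 128) := by
      rw [← mul_assoc, ← Real.rpow_add hTpos]
      norm_num
    calc M ^ (28 / 13 : ℝ) * T ^ (-(7 / 13 : ℝ))
        = M ^ ((2245 : ℝ) / 1664) *
          (T ^ (-((237 : ℝ) / 416)) * (T ^ ((1 : ℝ) / 32) * M ^ ((103 : ℝ) / 128))) := e1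
      _ ≤ T ^ ((237 : ℝ) / 416) *
          (T ^ (-((237 : ℝ) / 416)) * (T ^ ((1 : ℝ) / 32) * M ^ ((103 : ℝ) / 128))) :=
          mul_le_mul_of_nonneg_right h2245 (by positivity)
      _ = T ^ ((1 : ℝ) / 32) * M ^ ((103 : ℝ) / 128) := e2
  -- `M^ε ≤ T^ε`
  have hε' : M ^ ε ≤ T ^ ε := Real.rpow_le_rpow hMpos.le hMT1 hε.le
  have hsum : M ^ ε * (M ^ (9 / 13 : ℝ) * T ^ (1 / 13 : ℝ) + M ^ (28 / 13 : ℝ) * T ^ (-(7 / 13 : ℝ))) ≤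
      T ^ ε * (2 * (T ^ ((1 : ℝ) / 32) * M ^ ((103 : ℝ) / 128))) := by
    have : M ^ (9 / 13 : ℝ) * T ^ (1 / 13 : ℝ) + M ^ (28 / 13 : ℝ) * T ^ (-(7 / 13 : ℝ)) ≤
        2 * (T ^ ((1 : ℝ) / 32) * M ^ ((103 : ℝ) / 128)) := by linarith
    exact mul_le_mul hε' this (by positivity) (by positivity)
  have hfin : T ^ ε * (2 * (T ^ ((1 : ℝ) / 32) * M ^ ((103 : ℝ) / 128))) =
      2 * T ^ ((4 + 103 * (Real.log M / Real.log T)) / 128 + ε) := by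
    rw [hsplit, show (1 : ℝ) / 32 + ε = ε + (1 : ℝ) / 32 by ring, Real.rpow_add hTpos]
    ring
  calc ‖bourgainSum Real.log T M‖
      ≤ C * M ^ ε * (M ^ (9 / 13 : ℝ) * T ^ (1 / 13 : ℝ) + M ^ (28 / 13 : ℝ) * T ^ (-(7 / 13 : ℝ))) := hS
    _ = C * (M ^ ε * (M ^ (9 / 13 : ℝ) * T ^ (1 / 13 : ℝ) + M ^ (28 / 13 : ℝ) * T ^ (-(7 / 13 : ℝ)))) := by
        ring
    _ ≤ |C| * (M ^ ε * (M ^ (9 / 13 : ℝ) * T ^ (1 / 13 : ℝ) + M ^ (28 / 13 : ℝ) * T ^ (-(7 / 13 : ℝ)))) :=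
        mul_le_mul_of_nonneg_right (le_abs_self _) (by positivity)
    _ ≤ |C| * (T ^ ε * (2 * (T ^ ((1 : ℝ) / 32) * M ^ ((103 : ℝ) / 128)))) :=
        mul_le_mul_of_nonneg_left hsum (abs_nonneg _)
    _ = 2 * |C| * T ^ ((4 + 103 * (Real.log M / Real.log T)) / 128 + ε) := by rw [hfin]; ring

/-- **(4.1) for `F = log` on `T^{76/187} ≤ M ≤ √T`, conditionally on the Robert–Sargos test**
(`Sargos2003_lemma4`): `Bourgain2017_eq41_log_on_sargos_range` below `T^{92/223}` and the
unconditional `Bourgain2017_eq41_log_on_ge` above.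
[cite: Sargos2003, Lemma 4] [cite: BourgainJAMS2017, §5 (4.1), (4.2)] -/
theorem Bourgain2017_eq41_log_on_ge_of_sargos (h : Sargos2003_lemma4) :
    ∀ ε : ℝ, 0 < ε → ∃ C T₀ : ℝ, ∀ T : ℝ, T₀ ≤ T → ∀ M : ℝ,
      T ^ (76 / 187 : ℝ) ≤ M → M ≤ Real.sqrt T →
        ‖bourgainSum Real.log T M‖ ≤
          C * T ^ ((4 + 103 * (Real.log M / Real.log T)) / 128 + ε) := by
  intro ε hε
  obtain ⟨C₁, H₁⟩ := Bourgain2017_eq41_log_on_sargos_range h hε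
  obtain ⟨C₂, T₂, H₂⟩ := Bourgain2017_eq41_log_on_ge ε hε
  refine ⟨|C₁| + |C₂|, max T₂ 14400, ?_⟩
  intro T hT M hTM hMT
  have hT₂ : T₂ ≤ T := le_trans (le_max_left _ _) hT
  have hT' : (14400 : ℝ) ≤ T := le_trans (le_max_right _ _) hT
  have hX : 0 ≤ T ^ ((4 + 103 * (Real.log M / Real.log T)) / 128 + ε) := by positivity
  by_cases hc : M < T ^ (92 / 223 : ℝ)
  · calc ‖bourgainSum Real.log T M‖
        ≤ C₁ * T ^ ((4 + 103 * (Real.log M / Real.log T)) / 128 + ε) := H₁ T hT' M hTM hc.le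
      _ ≤ |C₁| * T ^ ((4 + 103 * (Real.log M / Real.log T)) / 128 + ε) :=
          mul_le_mul_of_nonneg_right (le_abs_self _) hX
      _ ≤ (|C₁| + |C₂|) * T ^ ((4 + 103 * (Real.log M / Real.log T)) / 128 + ε) :=
          mul_le_mul_of_nonneg_right (by linarith [abs_nonneg C₂]) hX
  · rw [not_lt] at hc
    calc ‖bourgainSum Real.log T M‖
        ≤ C₂ * T ^ ((4 + 103 * (Real.log M / Real.log T)) / 128 + ε) := H₂ T hT₂ M hc hMT
      _ ≤ |C₂| * T ^ ((4 + 103 * (Real.log M / Real.log T)) / 128 + ε) :=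
          mul_le_mul_of_nonneg_right (le_abs_self _) hX
      _ ≤ (|C₁| + |C₂|) * T ^ ((4 + 103 * (Real.log M / Real.log T)) / 128 + ε) :=
          mul_le_mul_of_nonneg_right (by linarith [abs_nonneg C₁]) hX

/-- **Reduction of the named fact to the core `T^{12/31} < M < T^{76/187}`, conditionally on the
Robert–Sargos test.** [cite: BourgainJAMS2017, §5 (4.1)] [cite: Sargos2003, Lemma 4]
[cite: Huxley1993, Theorem 3 (as quoted in Bourgain (4.1))] -/
theorem Bourgain2017_eq41_log_of_sargos_of_core (h : Sargos2003_lemma4)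
    (hcore : ∀ ε : ℝ, 0 < ε → ∃ C T₀ : ℝ, ∀ T : ℝ, T₀ ≤ T → ∀ M : ℝ,
      T ^ (12 / 31 : ℝ) < M → M < T ^ (76 / 187 : ℝ) →
        ‖bourgainSum Real.log T M‖ ≤
          C * T ^ ((4 + 103 * (Real.log M / Real.log T)) / 128 + ε)) :
    Bourgain2017_eq41_log :=
  Bourgain2017_eq41_log_of_split (76 / 187 : ℝ) hcore (Bourgain2017_eq41_log_on_ge_of_sargos h)

/-- **(4.1) for `F = log` on `T^{332/819} ≤ M ≤ √T`, conditionally on Bourgain's Theorem 4**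
(`Bourgain2017_theorem4_log`: `‖S‖ ≤ C √M T^{13/84+ε}` on `T^{17/42} ≤ M ≤ √T`, and
`332/819 > 17/42`): `√M T^{13/84+ε} = T^{83/672} · M^{1/2} T^{1/32+ε} ≤ M^{39/128} M^{1/2} T^{1/32+ε}
= T^{1/32+ε} M^{103/128}` as soon as `T^{332/819} ≤ M` (`(332/819)(39/128) = 83/672`).
[cite: BourgainJAMS2017, Theorem 4 (3.19); §5 (4.1)] -/
theorem Bourgain2017_eq41_log_on_ge_of_theorem4 (h4 : Bourgain2017_theorem4_log) :
    ∀ ε : ℝ, 0 < ε → ∃ C T₀ : ℝ, ∀ T : ℝ, T₀ ≤ T → ∀ M : ℝ,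
      T ^ (332 / 819 : ℝ) ≤ M → M ≤ Real.sqrt T →
        ‖bourgainSum Real.log T M‖ ≤
          C * T ^ ((4 + 103 * (Real.log M / Real.log T)) / 128 + ε) := by
  intro ε hε
  obtain ⟨C, T₀, H⟩ := h4 ε hε
  refine ⟨|C|, max T₀ 2, ?_⟩
  intro T hT M hTM hMT
  have hT₀ : T₀ ≤ T := le_trans (le_max_left _ _) hT
  have hT1 : (1 : ℝ) < T := by linarith [le_trans (le_max_right _ _) hT]
  have hTpos : (0 : ℝ) < T := by linarith
  have hM1 : (1 : ℝ) ≤ M := le_trans (Real.one_le_rpow hT1.le (by norm_num)) hTM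
  have hMpos : (0 : ℝ) < M := by linarith
  have h17 : T ^ (17 / 42 : ℝ) ≤ M :=
    le_trans (Real.rpow_le_rpow_of_exponent_le hT1.le (by norm_num)) hTM
  have hS := H T hT₀ M h17 hMT
  have hsplit := rpow_eq41_exponent hT1 hMpos ε
  -- `T^{83/672} ≤ M^{39/128}` from `T^{332/819} ≤ M`
  have h83 : T ^ ((83 : ℝ) / 672) ≤ M ^ ((39 : ℝ) / 128) := by
    calc T ^ ((83 : ℝ) / 672) = (T ^ (332 / 819 : ℝ)) ^ ((39 : ℝ) / 128) := by
          rw [← Real.rpow_mul hTpos.le]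
          norm_num
      _ ≤ M ^ ((39 : ℝ) / 128) := Real.rpow_le_rpow (by positivity) hTM (by norm_num)
  have key : Real.sqrt M * T ^ (13 / 84 + ε) ≤
      T ^ ((4 + 103 * (Real.log M / Real.log T)) / 128 + ε) := by
    have e1 : Real.sqrt M * T ^ (13 / 84 + ε) =
        T ^ ((83 : ℝ) / 672) * (M ^ ((1 : ℝ) / 2) * T ^ ((1 : ℝ) / 32 + ε)) := by
      rw [Real.sqrt_eq_rpow]
      simp only [Real.rpow_def_of_pos hTpos, Real.rpow_def_of_pos hMpos, ← Real.exp_add]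
      congr 1
      ring
    have e2 : M ^ ((39 : ℝ) / 128) * (M ^ ((1 : ℝ) / 2) * T ^ ((1 : ℝ) / 32 + ε)) =
        T ^ ((1 : ℝ) / 32 + ε) * M ^ ((103 : ℝ) / 128) := by
      simp only [Real.rpow_def_of_pos hTpos, Real.rpow_def_of_pos hMpos, ← Real.exp_add]
      congr 1
      ring
    rw [hsplit, e1, ← e2]
    exact mul_le_mul_of_nonneg_right h83 (by positivity)
  calc ‖bourgainSum Real.log T M‖ ≤ C * Real.sqrt M * T ^ (13 / 84 + ε) := hS
    _ = C * (Real.sqrt M * T ^ (13 / 84 + ε)) := by ring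
    _ ≤ |C| * (Real.sqrt M * T ^ (13 / 84 + ε)) :=
        mul_le_mul_of_nonneg_right (le_abs_self _) (by positivity)
    _ ≤ |C| * T ^ ((4 + 103 * (Real.log M / Real.log T)) / 128 + ε) :=
        mul_le_mul_of_nonneg_left key (abs_nonneg _)

/-- **Reduction of the named fact to the core `T^{12/31} < M < T^{332/819}`, conditionally on
Bourgain's Theorem 4** — the range on which §5 of the paper needs [H1], Theorem 3.
[cite: BourgainJAMS2017, Theorem 4 (3.19); §5 (4.1)]
[cite: Huxley1993, Theorem 3 (as quoted in Bourgain (4.1))] -/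
theorem Bourgain2017_eq41_log_of_theorem4_of_core (h4 : Bourgain2017_theorem4_log)
    (hcore : ∀ ε : ℝ, 0 < ε → ∃ C T₀ : ℝ, ∀ T : ℝ, T₀ ≤ T → ∀ M : ℝ,
      T ^ (12 / 31 : ℝ) < M → M < T ^ (332 / 819 : ℝ) →
        ‖bourgainSum Real.log T M‖ ≤
          C * T ^ ((4 + 103 * (Real.log M / Real.log T)) / 128 + ε)) :
    Bourgain2017_eq41_log :=
  Bourgain2017_eq41_log_of_split (332 / 819 : ℝ) hcore (Bourgain2017_eq41_log_on_ge_of_theorem4 h4)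

/-- **(4.1) for `F = log` on `T^{76/187} ≤ M ≤ √T` — PROVED.** The unconditional form of
`Literature.NumberTheory.LFunctions.Bourgain2017_eq41_log_on_ge_of_sargos`: the Robert–Sargos
fourth-derivative test `Literature.NumberTheory.LFunctions.Sargos2003_lemma4` is a theorem of this
tree (`Literature.NumberTheory.LFunctions.Sargos2003_lemma4_holds`), and on `M ≥ T^{76/187}` its
main term `M^{9/13} T^{1/13}` is at most `T^{1/32} M^{103/128}` (`76/187` being the exact
crossover), the secondary term `M^{28/13} T^{-7/13}` being smaller up to `M ≤ T^{948/2245}` and the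
exponent pair `(1/9, 13/18)` taking over from `M ≥ T^{92/223}`.
[cite: BourgainJAMS2017, §5 (4.1)] [cite: Sargos2003, Lemma 4]
[cite: RobertSargos2002, Theorem 1] -/
theorem Bourgain2017_eq41_log_on_ge_sargos :
    ∀ ε : ℝ, 0 < ε → ∃ C T₀ : ℝ, ∀ T : ℝ, T₀ ≤ T → ∀ M : ℝ,
      T ^ (76 / 187 : ℝ) ≤ M → M ≤ Real.sqrt T →
        ‖bourgainSum Real.log T M‖ ≤
          C * T ^ ((4 + 103 * (Real.log M / Real.log T)) / 128 + ε) :=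
  Bourgain2017_eq41_log_on_ge_of_sargos Sargos2003_lemma4_holds

/-- **Reduction of the named fact to the core `T^{12/31} < M < T^{76/187}` — PROVED
(unconditional).** `Literature.NumberTheory.LFunctions.Bourgain2017_eq41_log` follows from its own
restriction to `T^{12/31} < M < T^{76/187}` (`0.3870… < α < 0.4064…`), the rest of the range
`T^{76/187} ≤ M ≤ √T` being `Literature.NumberTheory.LFunctions.Bourgain2017_eq41_log_on_ge_sargos`.
On this core the only known source of the exponent `1/32 + 103α/128` is Huxley's once-differenced
Bombieri–Iwaniec theorem ([H1], Theorem 3 = [H], Theorem 17.4.2 with `R = 1`, Table 17.1).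
The hypothesis is the named fact verbatim with the extra constraint `M < T^{76/187}` (weaker than
the fact; not a named fact, D-0026).
[cite: BourgainJAMS2017, §5 (4.1)] [cite: Huxley1993, Theorem 3 (as quoted in Bourgain (4.1))] -/
theorem Bourgain2017_eq41_log_of_core_sargos
    (hcore : ∀ ε : ℝ, 0 < ε → ∃ C T₀ : ℝ, ∀ T : ℝ, T₀ ≤ T → ∀ M : ℝ,
      T ^ (12 / 31 : ℝ) < M → M < T ^ (76 / 187 : ℝ) →
        ‖bourgainSum Real.log T M‖ ≤
          C * T ^ ((4 + 103 * (Real.log M / Real.log T)) / 128 + ε)) :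
    Bourgain2017_eq41_log :=
  Bourgain2017_eq41_log_of_sargos_of_core Sargos2003_lemma4_holds hcore

end Literature.NumberTheory.LFunctions

end
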